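import Mathlib
import Summits.RiemannHypothesis.RiemannHypothesis.Theorems.IntegerScrewHubAlpha
import HarnessLib

/-!
# Route `IntegerScrew` — PROP. K″, leg `γ`: from the hubs down to the bottom (CONTINUUM-LIMIT §27.2 (b γ))

Leg `γ` of PROP. K″ carries, for every bottom node `b ≤ Q` and every hub `P ∈ (Q, Y]` (all primes of `P` exceed
`Q`), the mass `(1/b)·w_P` from `bP` down to `b` by deaths of the primes of `P`, smallest first.  For FIXED `b`
this is leg `α` for the function `z ↦ g(bz)` on the `Q`-rough numbers, so `IntegerScrewHubAlpha.hubAlpha_sq_le`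
prices it, with the Dirichlet form of `z ↦ g(bz)` on the rough `z ≤ Y` dominated by `b` times the Dirichlet terms
of `g` on `b·{rough}`; the sets `b·{rough ≤ Y}` (`b ≤ Q`) are pairwise disjoint in `[1, QY]` (unique
smooth × rough factorisation), and Cauchy–Schwarz over `b` with the weights `1/b` gives

* **`hubGamma_sq_le`** — for `1 ≤ Q`, `2 ≤ Y`, every `g`:
  `(Σ_{b≤Q}(1/b)·Σ_{P hub}(1/P)(g(bP) − g b))² ≤ H_Q·E_α(Q,Y)·D_{Ω_{QY}}(g)`,
  `E_α(Q,Y) = (4(1+e⁵)²/log²(Q+1))·(log Y + log 4 + e⁵·log(Y+1)·(log log Y + 4))`, `H_Q = Σ_{b≤Q}1/b`,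
  `D_{Ω_N}(g) = Σ_{x≤N}(1/x)Σ_{n∣x}Λ(n)(g x − g(x/n))²`.

RH-free, elementary.  Nothing in this file bears on the truth of RH.
References: CONTINUUM-LIMIT §27.2 (rh-explicit A6-PIVOT); M. Suzuki, J. Lond. Math. Soc. (2) 108 (2023) 1448–1487
[Suzuki2023] for the screw matrices this serves.
-/

noncomputable section

set_option linter.dupNamespace false -- D-0017: `Summit.<S>.<S>.…` is the designed namespace

namespace Summit.RiemannHypothesis.RiemannHypothesis.Theorems.IntegerScrew

open Finset Real
open ArithmeticFunction (vonMangoldt)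

/-- The Dirichlet terms of `z ↦ g(bz)` on a set `T` of `z ≥ 1` are at most `b` times the Dirichlet terms of `g` on
`b·T` (`n ∣ z ⇒ n ∣ bz` and `bz/n = b(z/n)`; the weight `1/z = b·(1/(bz))`). -/
theorem dirichlet_scaled_le {b : ℕ} (hb : 1 ≤ b) (T : Finset ℕ) (hT : ∀ z ∈ T, 1 ≤ z) (g : ℕ → ℝ) :
    ∑ z ∈ T, (1 / (z : ℝ)) * ∑ n ∈ z.divisors, (vonMangoldt n : ℝ) * (g (b * z) - g (b * (z / n))) ^ 2 ≤
      (b : ℝ) * ∑ z ∈ T, (1 / ((b * z : ℕ) : ℝ)) *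
        ∑ n ∈ (b * z).divisors, (vonMangoldt n : ℝ) * (g (b * z) - g (b * z / n)) ^ 2 := by
  rw [Finset.mul_sum]
  refine Finset.sum_le_sum fun z hz => ?_
  have hz1 := hT z hz
  have hb0 : (0 : ℝ) < b := by exact_mod_cast (show 0 < b by omega)
  have hz0 : (0 : ℝ) < z := by exact_mod_cast (show 0 < z by omega)
  have hw : (b : ℝ) * (1 / ((b * z : ℕ) : ℝ)) = 1 / (z : ℝ) := by
    push_cast; field_simp
  rw [← mul_assoc, hw]
  refine mul_le_mul_of_nonneg_left ?_ (by positivity)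
  have hsub : z.divisors ⊆ (b * z).divisors := Nat.divisors_subset_of_dvd (by positivity) (dvd_mul_left z b)
  calc ∑ n ∈ z.divisors, (vonMangoldt n : ℝ) * (g (b * z) - g (b * (z / n))) ^ 2
      = ∑ n ∈ z.divisors, (vonMangoldt n : ℝ) * (g (b * z) - g (b * z / n)) ^ 2 := by
        refine Finset.sum_congr rfl fun n hn => ?_
        rw [Nat.mul_div_assoc b (Nat.dvd_of_mem_divisors hn)]
    _ ≤ ∑ n ∈ (b * z).divisors, (vonMangoldt n : ℝ) * (g (b * z) - g (b * z / n)) ^ 2 :=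
        Finset.sum_le_sum_of_subset_of_nonneg hsub fun n _ _ =>
          mul_nonneg ArithmeticFunction.vonMangoldt_nonneg (sq_nonneg _)

/-- **Unique smooth × rough factorisation**: if `b₁ y₁ = b₂ y₂` with `b₁, b₂ ∈ [1, Q]` and every prime of `y₁`, `y₂`
at least `Q + 1` (`y₁, y₂ ≥ 1`), then `b₁ = b₂` and `y₁ = y₂`. -/
theorem smooth_mul_rough_inj {Q b₁ b₂ y₁ y₂ : ℕ} (hb₁ : b₁ ∈ Icc 1 Q) (hb₂ : b₂ ∈ Icc 1 Q)
    (hy₁ : 1 ≤ y₁) (hy₂ : 1 ≤ y₂) (hr₁ : ∀ q ∈ y₁.primeFactors, Q + 1 ≤ q)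
    (hr₂ : ∀ q ∈ y₂.primeFactors, Q + 1 ≤ q) (h : b₁ * y₁ = b₂ * y₂) : b₁ = b₂ ∧ y₁ = y₂ := by
  have hb₁' := Finset.mem_Icc.1 hb₁
  have hb₂' := Finset.mem_Icc.1 hb₂
  -- y₁ ⟂ b₂ and y₂ ⟂ b₁
  have cop : ∀ {y b : ℕ}, 1 ≤ y → b ∈ Icc 1 Q → (∀ q ∈ y.primeFactors, Q + 1 ≤ q) → Nat.Coprime y b := by
    intro y b hy hb hr
    have hb' := Finset.mem_Icc.1 hb
    refine Nat.coprime_of_dvd fun k hk hky hkb => ?_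
    have h1 := hr k (Nat.mem_primeFactors.2 ⟨hk, hky, by omega⟩)
    have h2 := Nat.le_of_dvd (by omega) hkb
    omega
  have h12 : y₁ ∣ y₂ := by
    have : y₁ ∣ y₂ * b₂ := ⟨b₁, by rw [mul_comm y₂, ← h]; ring⟩
    exact (cop hy₁ hb₂ hr₁).dvd_of_dvd_mul_right this
  have h21 : y₂ ∣ y₁ := by
    have : y₂ ∣ y₁ * b₁ := ⟨b₂, by rw [mul_comm y₁, h]; ring⟩
    exact (cop hy₂ hb₁ hr₂).dvd_of_dvd_mul_right this
  have hy : y₁ = y₂ := Nat.dvd_antisymm h12 h21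
  subst hy
  exact ⟨Nat.eq_of_mul_eq_mul_right (by omega) h, rfl⟩

/-- **PROP. K″, leg `γ` (CONTINUUM-LIMIT §27.2 (b γ)), inside an atom**: for `1 ≤ Q < N`, `2 ≤ Y < N` and every `g`,
with the hubs `{P ∈ (Q, Y] : every prime of P ≥ Q+1}` (all `N`-smooth since `Y < N`):
`(Σ_{b≤Q}(1/b)·Σ_{P hub}(1/P)(g(bP) − g b))² ≤
  H_Q·(4(1+e⁵)²/log²(Q+1))·(log Y + log 4 + e⁵·log(Y+1)·(log log Y + 4))·Σ_{x≤QY, x N-smooth}(1/x)Σ_{n∣x}Λ(n)(g x − g(x/n))²`. -/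
theorem hubGamma_sq_le_smooth {Q Y N : ℕ} (hQ : 1 ≤ Q) (hY : 2 ≤ Y) (hQN : Q < N) (hYN : Y < N) (g : ℕ → ℝ) :
    (∑ b ∈ Icc 1 Q, (1 / (b : ℝ)) *
        ∑ P ∈ (Ioc Q Y).filter (fun r => ∀ q ∈ r.primeFactors, Q + 1 ≤ q), (1 / (P : ℝ)) * (g (b * P) - g b)) ^ 2 ≤
      (∑ b ∈ Icc 1 Q, 1 / (b : ℝ)) *
        (4 * (1 + Real.exp 5) ^ 2 / Real.log ((Q : ℝ) + 1) ^ 2 *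
          (Real.log Y + Real.log 4 + Real.exp 5 * Real.log ((Y : ℝ) + 1) * (Real.log (Real.log Y) + 4))) *
        ∑ x ∈ (Icc 1 (Q * Y)).filter (· ∈ Nat.smoothNumbers N),
          (1 / (x : ℝ)) * ∑ n ∈ x.divisors, (vonMangoldt n : ℝ) * (g x - g (x / n)) ^ 2 := by
  set H := (Ioc Q Y).filter (fun r => ∀ q ∈ r.primeFactors, Q + 1 ≤ q) with hH
  set T := (Icc 2 Y).filter (fun r => ∀ q ∈ r.primeFactors, Q + 1 ≤ q) with hT
  set E := 4 * (1 + Real.exp 5) ^ 2 / Real.log ((Q : ℝ) + 1) ^ 2 *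
    (Real.log Y + Real.log 4 + Real.exp 5 * Real.log ((Y : ℝ) + 1) * (Real.log (Real.log Y) + 4)) with hE
  set Φ : ℕ → ℝ := fun b => ∑ P ∈ H, (1 / (P : ℝ)) * (g (b * P) - g b) with hΦ
  set F : ℕ → ℝ := fun x => (1 / (x : ℝ)) * ∑ n ∈ x.divisors, (vonMangoldt n : ℝ) * (g x - g (x / n)) ^ 2 with hF
  have hF0 : ∀ x, 0 ≤ F x := fun x => mul_nonneg (by positivity)
    (Finset.sum_nonneg fun n _ => mul_nonneg ArithmeticFunction.vonMangoldt_nonneg (sq_nonneg _))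
  -- E ≥ 0
  have hY2 : (2 : ℝ) ≤ Y := by exact_mod_cast hY
  have hE0 : 0 ≤ E := by
    have h1 : 0 ≤ Real.log Y := Real.log_nonneg (by linarith)
    have h2 : 0 ≤ Real.log 4 := Real.log_nonneg (by norm_num)
    have h3 : 0 ≤ Real.log ((Y : ℝ) + 1) := Real.log_nonneg (by linarith)
    have h4 : 0 ≤ Real.log (Real.log Y) + 4 := by
      have hl2 : (1 : ℝ) / 2 < Real.log 2 := by linarith [Real.log_two_gt_d9]
      have hlY : Real.log 2 ≤ Real.log Y := Real.log_le_log (by norm_num) hY2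
      have hll : Real.log (1 / 2) ≤ Real.log (Real.log Y) := Real.log_le_log (by norm_num) (by linarith)
      have : Real.log (1 / 2) = -Real.log 2 := by rw [one_div, Real.log_inv]
      linarith [Real.log_two_lt_d9]
    positivity
  -- Step 1–2: for each b ≥ 1, Φ_b² ≤ E · b · Σ_{z∈T} Dl b z
  have hstep : ∀ b ∈ Icc 1 Q, Φ b ^ 2 ≤ E * ((b : ℝ) * ∑ z ∈ T, F (b * z)) := by
    intro b hb
    have hb1 := (Finset.mem_Icc.1 hb).1
    have h := hubAlpha_sq_le hQ hY (fun z => g (b * z))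
    simp only [mul_one] at h
    refine h.trans (mul_le_mul_of_nonneg_left ?_ hE0)
    have hd := dirichlet_scaled_le hb1 T
      (fun z hz => by have := (Finset.mem_Icc.1 (Finset.mem_filter.1 hz).1).1; omega) g
    simpa only [hF] using hd
  -- Step 3: Cauchy–Schwarz over b with weights 1/b
  have hCS : (∑ b ∈ Icc 1 Q, (1 / (b : ℝ)) * Φ b) ^ 2 ≤
      (∑ b ∈ Icc 1 Q, 1 / (b : ℝ)) * ∑ b ∈ Icc 1 Q, (1 / (b : ℝ)) * Φ b ^ 2 := by
    refine Finset.sum_sq_le_sum_mul_sum_of_sq_le_mul (Icc 1 Q) (fun b _ => by positivity)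
      (fun b _ => by positivity) (fun b hb => le_of_eq ?_)
    ring
  -- Step 4: Σ_b (1/b)Φ_b² ≤ E Σ_b Σ_T Dl ≤ E · D_{Icc 1 (QY)}
  have hsum : ∑ b ∈ Icc 1 Q, (1 / (b : ℝ)) * Φ b ^ 2 ≤ E * ∑ b ∈ Icc 1 Q, ∑ z ∈ T, F (b * z) := by
    rw [Finset.mul_sum]
    refine Finset.sum_le_sum fun b hb => ?_
    have hb1 := (Finset.mem_Icc.1 hb).1
    have hb0 : (0 : ℝ) < b := by exact_mod_cast (show 0 < b by omega)
    calc (1 / (b : ℝ)) * Φ b ^ 2 ≤ (1 / (b : ℝ)) * (E * ((b : ℝ) * ∑ z ∈ T, F (b * z))) :=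
          mul_le_mul_of_nonneg_left (hstep b hb) (by positivity)
      _ = E * ∑ z ∈ T, F (b * z) := by field_simp
  have hunion : ∑ b ∈ Icc 1 Q, ∑ z ∈ T, F (b * z) ≤ ∑ x ∈ (Icc 1 (Q * Y)).filter (· ∈ Nat.smoothNumbers N), F x := by
    rw [← Finset.sum_product' (f := fun b z => F (b * z))]
    have hinj : Set.InjOn (fun z : ℕ × ℕ => z.1 * z.2) ↑(Icc 1 Q ×ˢ T) := by
      intro z hz z' hz' hzz
      have hz1 := (Finset.mem_product.1 (Finset.mem_coe.1 hz))
      have hz2 := (Finset.mem_product.1 (Finset.mem_coe.1 hz'))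
      have hT1 := Finset.mem_filter.1 hz1.2
      have hT2 := Finset.mem_filter.1 hz2.2
      have := smooth_mul_rough_inj hz1.1 hz2.1 (by have := (Finset.mem_Icc.1 hT1.1).1; omega)
        (by have := (Finset.mem_Icc.1 hT2.1).1; omega) hT1.2 hT2.2 hzz
      exact Prod.ext this.1 this.2
    have himg : (Icc 1 Q ×ˢ T).image (fun z : ℕ × ℕ => z.1 * z.2) ⊆
        (Icc 1 (Q * Y)).filter (· ∈ Nat.smoothNumbers N) := by
      intro x hx
      obtain ⟨z, hz, rfl⟩ := Finset.mem_image.1 hx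
      have hz' := Finset.mem_product.1 hz
      have hb := Finset.mem_Icc.1 hz'.1
      have ht := Finset.mem_Icc.1 (Finset.mem_filter.1 hz'.2).1
      refine Finset.mem_filter.2 ⟨Finset.mem_Icc.2 ⟨Nat.one_le_iff_ne_zero.2 (Nat.mul_ne_zero (by omega) (by omega)),
        Nat.mul_le_mul hb.2 ht.2⟩, ?_⟩
      exact Nat.mul_mem_smoothNumbers (Nat.mem_smoothNumbers_of_lt (by omega) (by omega))
        (Nat.mem_smoothNumbers_of_lt (by omega) (by omega))
    rw [← Finset.sum_image (f := F) (g := fun z : ℕ × ℕ => z.1 * z.2) hinj]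
    exact Finset.sum_le_sum_of_subset_of_nonneg himg fun x _ _ => hF0 x
  have hHQ0 : 0 ≤ ∑ b ∈ Icc 1 Q, 1 / (b : ℝ) := Finset.sum_nonneg fun b _ => by positivity
  calc (∑ b ∈ Icc 1 Q, (1 / (b : ℝ)) * Φ b) ^ 2
      ≤ (∑ b ∈ Icc 1 Q, 1 / (b : ℝ)) * ∑ b ∈ Icc 1 Q, (1 / (b : ℝ)) * Φ b ^ 2 := hCS
    _ ≤ (∑ b ∈ Icc 1 Q, 1 / (b : ℝ)) * (E * ∑ x ∈ (Icc 1 (Q * Y)).filter (· ∈ Nat.smoothNumbers N), F x) :=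
        mul_le_mul_of_nonneg_left (hsum.trans (mul_le_mul_of_nonneg_left hunion hE0)) hHQ0
    _ = _ := by ring

/-- **PROP. K″, leg `γ` (CONTINUUM-LIMIT §27.2 (b γ))**, full form: for `1 ≤ Q`, `2 ≤ Y` and every `g`,
`(Σ_{b≤Q}(1/b)·Σ_{P hub}(1/P)(g(bP) − g b))² ≤ H_Q·E_α(Q,Y)·Σ_{x≤QY}(1/x)Σ_{n∣x}Λ(n)(g x − g(x/n))²`. -/
theorem hubGamma_sq_le {Q Y : ℕ} (hQ : 1 ≤ Q) (hY : 2 ≤ Y) (g : ℕ → ℝ) :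
    (∑ b ∈ Icc 1 Q, (1 / (b : ℝ)) *
        ∑ P ∈ (Ioc Q Y).filter (fun r => ∀ q ∈ r.primeFactors, Q + 1 ≤ q), (1 / (P : ℝ)) * (g (b * P) - g b)) ^ 2 ≤
      (∑ b ∈ Icc 1 Q, 1 / (b : ℝ)) *
        (4 * (1 + Real.exp 5) ^ 2 / Real.log ((Q : ℝ) + 1) ^ 2 *
          (Real.log Y + Real.log 4 + Real.exp 5 * Real.log ((Y : ℝ) + 1) * (Real.log (Real.log Y) + 4))) *
        ∑ x ∈ Icc 1 (Q * Y), (1 / (x : ℝ)) * ∑ n ∈ x.divisors, (vonMangoldt n : ℝ) * (g x - g (x / n)) ^ 2 := by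
  have h := hubGamma_sq_le_smooth (N := Q * Y + 1) hQ hY (by nlinarith) (by nlinarith) g
  have hall : (Icc 1 (Q * Y)).filter (· ∈ Nat.smoothNumbers (Q * Y + 1)) = Icc 1 (Q * Y) :=
    Finset.filter_true_of_mem fun x hx => by
      have := Finset.mem_Icc.1 hx; exact Nat.mem_smoothNumbers_of_lt (by omega) (by omega)
  rw [hall] at h
  exact h

end Summit.RiemannHypothesis.RiemannHypothesis.Theorems.IntegerScrew

end
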